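import Summits.BirchSwinnertonDyer.BirchSwinnertonDyer.Theorems.SignedLowerHalvesSprungLowerDivisibilityAtThreeColourTransfer
import Summits.BirchSwinnertonDyer.BirchSwinnertonDyer.Theorems.SignedLowerHalvesSprungLowerDivisibilityAtThreeBothColours
import Literature.NumberTheory.EllipticCurves.KatoFineSelmerDualProofs
import HarnessLib

/-!
# Crux `SprungLowerDivisibilityAtThree` (item stmt-BirchSwinnertonDyer-19875), line `chromatic-common-zeros`, skeleton v8:
# stub S4b-cyc `stub_cyclotomicLowerPosLevel` IN THE SAME LEDGER CURRENCY AS K_spor — it is Kato's fine inequality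
# `k ≤ x` at the POSITIVE-LEVEL CYCLOTOMIC common zeros, so the cokernel bound F-α (valid at every height-one `𝔭 ≠ (T)`)
# and the residue `{j < k}` reshape BOTH open stubs of the line (x8 children C1′ 22569 AND C2R 22570)

Cell `bsd-ssimc` (host), width seat `cruxlead-stmt-BirchSwinnertonDyer-19875-w3` (gen 6) under the 19875 LEAD; `--supports`
stmt-BirchSwinnertonDyer-19875 `--as helper`; theorems only (no `def`, no named fact); closes NO item. HONEST FRAMING: a
RESTATEMENT of the open stub S4b-cyc (Sprung 2012 Main Conj. 7.21, Eisenstein half, at the primes `(Φ_{3^j}(1+T))`, `j ≥ 1` =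
the exceptional twisted zeros) in the currency of the K_spor ledger (`…KatoSporadicLedger{,Joint,Door,X8,Kato,Iota,Orbit}`);
S4b-cyc, K_spor, K1, leaf X8 and BSD are NOT proved by anything here.

THE POINT. At ANY height-one prime `𝔭` the local Eisenstein inequality of a non-vanishing colour `•`,
`ℓ_𝔭 Λ/(G^•) ≤ ℓ_𝔭 X^•`, is EQUIVALENT to Kato's colour-free fine inequality `k(𝔭) = ℓ_𝔭(𝐇¹/Z) ≤ ℓ_𝔭 X₀ = x(𝔭)`
(`SharpFlatColemanKatoData.eisenstein_iff_fine`, p607724) — this is how K_spor was extracted from S4 at the SPORADIC primes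
(v7). The same extraction at the positive-level CYCLOTOMIC primes turns S4b-cyc into «`k ≤ x` at every cyclotomic common zero
of positive level» (§1), and the ledger door of `…KatoSporadicLedgerDoor` applies VERBATIM there (§2): the joint Coleman map
`(Col♯, Col♭)` has cokernel `Λ/(T)` (Kurihara–Pollack / Sprung §7.1 / Lei–Sujatha (SES-KP)), so the cokernel bound F-α
«`j(𝔭) ≤ x(𝔭)`» is in print at every height-one `𝔭 ≠ (T)` off the Tate lines — sporadic AND cyclotomic of positive
level alike. Hence ONE typed fact F-α (the LEAD g4's planned child-22569 stub `stub_sporadicCokerBound`, stated off `(T)`)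
serves BOTH children, and the line's whole off-`(T)` residue is «`k ≤ x` on `{j < k}`» in both prime families.

* §1 `stub_cyclotomicLowerPosLevel_of_katoFineLowerAt (hfine)`: S4b-cyc VERBATIM from (hfine) «`k(𝔭) ≤ x(𝔭)` for every fine
  dual datum `Y` at every positive-level cyclotomic common zero `𝔭`» (colour-free; `eisenstein_iff_fine` for the guard
  colour; `Y` exists by `nonempty_fineSelmerDualData`; `E[3]` irreducible and `G ≠ 0` are automatic on X8).
* §2 `stub_cyclotomicLowerPosLevel_of_ledgerDoor (hFα) (hres)`: S4b-cyc VERBATIM from the cokernel bound at the positive-level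
  cyclotomic common zeros and the residue «`k ≤ x` on `{j < k}` there» — the literal twin of
  `stub_katoFineLowerSporadic_of_ledgerDoor` (p648498).
The unified off-`(T)` door (both stubs from ONE pair (F-α, R) with binders `p ∉ 𝔭`, `T ∉ 𝔭`) is the sibling file
`…OffTLedgerDoor.lean`.

References: [Sprung2012] Thm. 7.14 (3) (p. 1504), Prop. 7.19, Main Conj. 7.21 (p. 1505), §7.1 Props. 7.3/7.6; [Kato2004Asterisque]
Conj. 12.10 (p. 224), §17.13 with (17.13.1) (p. 280); [KuriharaPollack2007] Prop. 1.2, Thm. 1.3; [LeiSujatha2021] (SES-KP);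
[Wingberg1989] Cor. 2.5 / [Matar2020] Thm. 1.1; [Rohrlich1984] (exceptional zeros are finite in number); tree: `…ColourTransfer`
(p607724), `…BothColours` (p621881), `…KatoSporadicLedgerDoor` (p648498), `Lines/chromatic_common_zeros.lean` v8 :206 (S4b-cyc).
-/

set_option linter.dupNamespace false
set_option autoImplicit false

noncomputable section

open scoped Classical NumberField MatrixGroups ModularForm

open NumberField IsDedekindDomain CongruenceSubgroup WeierstrassCurve Field
  Literature.NumberTheory.EllipticCurves Literature.NumberTheory.EllipticCurves.ModularForms
  Literature.NumberTheory.EllipticCurves.ZpExtension Literature.NumberTheory.EllipticCurves.Sprung2017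
  Literature.NumberTheory.EllipticCurves.Sprung2012 Literature.NumberTheory.EllipticCurves.Rank1Residual
  Literature.NumberTheory.EllipticCurves.IwasawaAlgebra Literature.NumberTheory.EllipticCurves.Kato2004
  Literature.NumberTheory.EllipticCurves.Module
  Summit.BirchSwinnertonDyer.BirchSwinnertonDyer.Theorems
  Summit.BirchSwinnertonDyer.BirchSwinnertonDyer.Theorems.SmallImageSignedMuDefect

namespace Summit.BirchSwinnertonDyer.BirchSwinnertonDyer.Theorems.ChromaticCommonZeros

/-- `ϖ ≠ 0` when `ϖ·Ω_E = Ω⁺_f` (`Ω⁺_f > 0`; private plumbing, = `IsNewformOf.periodRatio_ne_zero`).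
[cite: MazurTateTeitelbaum1986Invent, §I.8 (8.6)] -/
private theorem periodRatio_ne_zero_aux' {W : WeierstrassCurve ℚ} {N : ℕ} [NeZero N] {f : CuspForm (Gamma0 N) 2}
    (hf : IsNewformOf W f) {ϖ : ℚ} (hϖ : (ϖ : ℝ) * W.realPeriodRat = plusPeriod f) : ϖ ≠ 0 := by
  rintro rfl
  have hpos : 0 < plusPeriod f := IsNewform0.plusPeriod_pos_holds hf.1 hf.coeffField_eq_bot
  rw [Rat.cast_zero, zero_mul] at hϖ
  exact hpos.ne hϖ

/-- A Néron-normalised `G` of a non-zero colour is non-zero (`ϖ ≠ 0`; private plumbing). [cite: Sprung2012, Def. 6.1] -/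
private theorem normalised_ne_zero' {p : ℕ} [Fact p.Prime] {ϖ : ℚ} (hϖ0 : ϖ ≠ 0) {L G : IwasawaAlgebra p} (hL : L ≠ 0)
    (hG : iwasawaToPowerSeries p G = PowerSeries.C ((ϖ : ℚ) : ℚ_[p]) * iwasawaToPowerSeries p L) : G ≠ 0 := by
  intro h0
  rw [h0, map_zero, eq_comm, mul_eq_zero] at hG
  rcases hG with hC | hL'
  · have h1 : ((ϖ : ℚ) : ℚ_[p]) = 0 := by simpa using congrArg PowerSeries.constantCoeff hC
    exact hϖ0 (by exact_mod_cast h1)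
  · exact hL (iwasawaToPowerSeries_injective p (by rw [hL', map_zero]))

/-! ### §1 S4b-cyc is Kato's fine inequality at the positive-level cyclotomic common zeros -/

/-- **S4b-cyc ⟸ «`k ≤ x` at every positive-level cyclotomic common zero» (colour-free form of the stub).** If, over the
stub's joint binders (X8 pair, cyclotomic/Honda setting, newform and Sprung pair, `I, Cs, Cf` with `Cs.Z = Cf.Z`), at every
height-one `𝔭 ∌ T` containing some `Φ_{p^j}(1+T)`, `j ≥ 1`, and every colour's normalised `L`-function, Kato's fine
inequality `ℓ_𝔭(I.H ⧸ Cs.Z) ≤ ℓ_𝔭 Y.X` holds for EVERY fine dual datum `Y`, then the registered stub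
`stub_cyclotomicLowerPosLevel` (v8 :206) holds VERBATIM: for the guard colour `•` (`L^• ≠ 0`, hence `G ≠ 0` on X8) the
four-term identity converts `k ≤ x` into `ℓ_𝔭 Λ/(G) ≤ ℓ_𝔭 X^•` (`eisenstein_iff_fine`). [cite: Sprung2012, Thm. 7.14 (3), Prop. 7.19, Main Conj. 7.21 (p. 1505)]
[cite: Kato2004Asterisque, Conj. 12.10 (p. 224), §17.13 (p. 280)] -/
theorem stub_cyclotomicLowerPosLevel_of_katoFineLowerAt
    (hfine : ∀ (W : WeierstrassCurve ℚ) [W.IsElliptic] [W.IsGloballyMinimal] (p : ℕ) [Fact p.Prime]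
      [ContinuousSMul ℤ_[p] (W.tateModule p)] [Module.Free ℤ_[p] (W.tateModule p)]
      [Module.Finite ℤ_[p] (W.tateModule p)],
      ClassX8 W p → ∀ (κ : ZpExtension ℚ p) (γ : Field.absoluteGaloisGroup ℚ),
      κ.IsCyclotomic → κ.IsTopGenerator γ → IsCyclotomicVariable p γ →
    ∀ (v : HeightOneSpectrum (𝓞 ℚ)), (p : 𝓞 ℚ) ∈ v.asIdeal →
    ∀ (g : Field.absoluteGaloisGroup (v.adicCompletion ℚ)),
      κ.IsTopGenerator (resGalOfEmb (closureEmb (K := ℚ) (v.adicCompletion ℚ)) g) →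
    ∀ (cneg : localPoints W (v.adicCompletion ℚ)) (c : ℕ → localPoints W (v.adicCompletion ℚ)),
      IsHondaSystem κ (closureEmb (K := ℚ) (v.adicCompletion ℚ)) W (W.frobeniusTrace p) g cneg c →
    ∀ (N : ℕ) (_ : NeZero N) (f : CuspForm (Gamma0 N) 2) (ϖ : ℚ) (Lsharp Lflat : IwasawaAlgebra p),
      IsNewformOf W f → (ϖ : ℝ) * W.realPeriodRat = plusPeriod f →
      IsSprungPair f p (W.frobeniusTrace p) Lsharp Lflat →
    ∀ (I : Kato2004.IwasawaH1Data W p κ γ)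
      (Cs : SharpFlatColemanKatoData W p f ϖ κ γ (closureEmb (K := ℚ) (v.adicCompletion ℚ))
        (W.frobeniusTrace p) g c Chroma.sharp I)
      (Cf : SharpFlatColemanKatoData W p f ϖ κ γ (closureEmb (K := ℚ) (v.adicCompletion ℚ))
        (W.frobeniusTrace p) g c Chroma.flat I),
      Cs.Z = Cf.Z →
    ∀ (Y : W.FineSelmerDualData κ γ) (𝔭 : PrimeSpectrum (IwasawaAlgebra p)), 𝔭.asIdeal.height = 1 →
      (PowerSeries.X : IwasawaAlgebra p) ∉ 𝔭.asIdeal →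
      (∃ j : ℕ, 1 ≤ j ∧
        ((((Polynomial.cyclotomic (p ^ j) ℤ).comp (Polynomial.X + 1)).map (Int.castRingHom ℤ_[p]) : Polynomial ℤ_[p]) :
          PowerSeries ℤ_[p]) ∈ 𝔭.asIdeal) →
      (∀ (col' : Chroma) (G' : IwasawaAlgebra p),
        iwasawaToPowerSeries p G' =
          PowerSeries.C (ϖ : ℚ_[p]) * iwasawaToPowerSeries p (chromaticL col' Lsharp Lflat) →
        G' ∈ 𝔭.asIdeal) →
      Module.lengthAt (IwasawaAlgebra p) (I.H ⧸ Cs.Z) 𝔭 ≤ Module.lengthAt (IwasawaAlgebra p) Y.X 𝔭) :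
    ∀ (W : WeierstrassCurve ℚ) [W.IsElliptic] [W.IsGloballyMinimal] (p : ℕ) [Fact p.Prime]
      [ContinuousSMul ℤ_[p] (W.tateModule p)] [Module.Free ℤ_[p] (W.tateModule p)]
      [Module.Finite ℤ_[p] (W.tateModule p)],
      ClassX8 W p → ∀ (col : Chroma) (κ : ZpExtension ℚ p) (γ : Field.absoluteGaloisGroup ℚ),
      κ.IsCyclotomic → κ.IsTopGenerator γ → IsCyclotomicVariable p γ →
    ∀ (v : HeightOneSpectrum (𝓞 ℚ)), (p : 𝓞 ℚ) ∈ v.asIdeal →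
    ∀ (g : Field.absoluteGaloisGroup (v.adicCompletion ℚ)),
      κ.IsTopGenerator (resGalOfEmb (closureEmb (K := ℚ) (v.adicCompletion ℚ)) g) →
    ∀ (cneg : localPoints W (v.adicCompletion ℚ)) (c : ℕ → localPoints W (v.adicCompletion ℚ)),
      IsHondaSystem κ (closureEmb (K := ℚ) (v.adicCompletion ℚ)) W (W.frobeniusTrace p) g cneg c →
    ∀ (N : ℕ) (_ : NeZero N) (f : CuspForm (Gamma0 N) 2) (ϖ : ℚ) (Lsharp Lflat : IwasawaAlgebra p),
      IsNewformOf W f → (ϖ : ℝ) * W.realPeriodRat = plusPeriod f →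
      IsSprungPair f p (W.frobeniusTrace p) Lsharp Lflat → chromaticL col Lsharp Lflat ≠ 0 →
    ∀ (D : SharpFlatSelmerDualData W κ γ (closureEmb (K := ℚ) (v.adicCompletion ℚ))
        (W.frobeniusTrace p) g c col) [Module.Finite (IwasawaAlgebra p) D.X],
      Module.IsTorsion (IwasawaAlgebra p) D.X →
    ∀ (G : IwasawaAlgebra p),
      iwasawaToPowerSeries p G =
        PowerSeries.C (ϖ : ℚ_[p]) * iwasawaToPowerSeries p (chromaticL col Lsharp Lflat) →
    ∀ (I : Kato2004.IwasawaH1Data W p κ γ)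
      (Cs : SharpFlatColemanKatoData W p f ϖ κ γ (closureEmb (K := ℚ) (v.adicCompletion ℚ))
        (W.frobeniusTrace p) g c Chroma.sharp I)
      (Cf : SharpFlatColemanKatoData W p f ϖ κ γ (closureEmb (K := ℚ) (v.adicCompletion ℚ))
        (W.frobeniusTrace p) g c Chroma.flat I),
      Cs.Z = Cf.Z →
    ∀ 𝔭 : PrimeSpectrum (IwasawaAlgebra p), 𝔭.asIdeal.height = 1 →
      (PowerSeries.X : IwasawaAlgebra p) ∉ 𝔭.asIdeal →
      (∃ j : ℕ, 1 ≤ j ∧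
        ((((Polynomial.cyclotomic (p ^ j) ℤ).comp (Polynomial.X + 1)).map (Int.castRingHom ℤ_[p]) : Polynomial ℤ_[p]) :
          PowerSeries ℤ_[p]) ∈ 𝔭.asIdeal) →
      (∀ (col' : Chroma) (G' : IwasawaAlgebra p),
        iwasawaToPowerSeries p G' =
          PowerSeries.C (ϖ : ℚ_[p]) * iwasawaToPowerSeries p (chromaticL col' Lsharp Lflat) →
        G' ∈ 𝔭.asIdeal) →
      Module.lengthAt (IwasawaAlgebra p) (IwasawaAlgebra p ⧸ Ideal.span {G}) 𝔭 ≤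
        Module.lengthAt (IwasawaAlgebra p) D.X 𝔭 := by
  intro W _ _ p _ _ _ _ hX col κ γ hκ hγ hcv v hv g hg cneg c hH N hN f ϖ Lsharp Lflat hf hϖ hSP hcol D _ hXt G hG
    I Cs Cf hZ 𝔭 h𝔭 hT hΦ hcommon
  haveI : NeZero N := hN
  obtain ⟨Y⟩ := W.nonempty_fineSelmerDualData κ hγ
  have hk := hfine W p hX κ γ hκ hγ hcv v hv g hg cneg c hH N hN f ϖ Lsharp Lflat hf hϖ hSP I Cs Cf hZ Y 𝔭 h𝔭 hT hΦ hcommon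
  have hirr : W.HasIrreducibleModPGaloisRep p := ClassX8.irr' W p hX
  have hG0 : G ≠ 0 := normalised_ne_zero' (periodRatio_ne_zero_aux' hf hϖ) hcol hG
  cases col with
  | sharp => exact (Cs.eisenstein_iff_fine W p hirr hSP hcol hG hG0 D hXt Y 𝔭 h𝔭).mpr hk
  | flat =>
    rw [hZ] at hk
    exact (Cf.eisenstein_iff_fine W p hirr hSP hcol hG hG0 D hXt Y 𝔭 h𝔭).mpr hk

/-! ### §2 The ledger door for S4b-cyc -/

/-- **S4b-cyc ⟸ F-α ∧ R at the positive-level cyclotomic common zeros** (the literal twin of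
`stub_katoFineLowerSporadic_of_ledgerDoor`, p648498): (hFα) the COKERNEL BOUND «`min_• ℓ_𝔭(Λ ⧸ range C•.colMap) ≤ ℓ_𝔭 Y.X`»
at those primes — IN PRINT there exactly as at the sporadic primes (the joint Coleman cokernel is `Λ/(T)`, so the bound is
valid at EVERY height-one `𝔭 ≠ (T)` off the Tate lines; Poitou–Tate; Wingberg/Matar WITH the `ι`), displayed; (hres) the
RESIDUE «`k ≤ x` where `j < k`» at those primes (Sprung 2012 Main Conj. 7.21 ⊆ content; conjecturally EMPTY: a cyclotomic
common zero of positive level is an exceptional twisted zero `L(E, χ, 1) = 0`). A literal case split composed with §1.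
[cite: Sprung2012, §7.1, Props. 7.3/7.6, Main Conj. 7.21 (p. 1505)] [cite: Kato2004Asterisque, (17.13.1) (p. 280)]
[cite: KuriharaPollack2007, Prop. 1.2] [cite: Wingberg1989, Cor. 2.5] [cite: Matar2020, Thm. 1.1] -/
theorem stub_cyclotomicLowerPosLevel_of_ledgerDoor
    (hFα : ∀ (W : WeierstrassCurve ℚ) [W.IsElliptic] [W.IsGloballyMinimal] (p : ℕ) [Fact p.Prime]
      [ContinuousSMul ℤ_[p] (W.tateModule p)] [Module.Free ℤ_[p] (W.tateModule p)]
      [Module.Finite ℤ_[p] (W.tateModule p)],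
      ClassX8 W p → ∀ (κ : ZpExtension ℚ p) (γ : Field.absoluteGaloisGroup ℚ),
      κ.IsCyclotomic → κ.IsTopGenerator γ → IsCyclotomicVariable p γ →
    ∀ (v : HeightOneSpectrum (𝓞 ℚ)), (p : 𝓞 ℚ) ∈ v.asIdeal →
    ∀ (g : Field.absoluteGaloisGroup (v.adicCompletion ℚ)),
      κ.IsTopGenerator (resGalOfEmb (closureEmb (K := ℚ) (v.adicCompletion ℚ)) g) →
    ∀ (cneg : localPoints W (v.adicCompletion ℚ)) (c : ℕ → localPoints W (v.adicCompletion ℚ)),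
      IsHondaSystem κ (closureEmb (K := ℚ) (v.adicCompletion ℚ)) W (W.frobeniusTrace p) g cneg c →
    ∀ (N : ℕ) (_ : NeZero N) (f : CuspForm (Gamma0 N) 2) (ϖ : ℚ) (Lsharp Lflat : IwasawaAlgebra p),
      IsNewformOf W f → (ϖ : ℝ) * W.realPeriodRat = plusPeriod f →
      IsSprungPair f p (W.frobeniusTrace p) Lsharp Lflat →
    ∀ (I : Kato2004.IwasawaH1Data W p κ γ)
      (Cs : SharpFlatColemanKatoData W p f ϖ κ γ (closureEmb (K := ℚ) (v.adicCompletion ℚ))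
        (W.frobeniusTrace p) g c Chroma.sharp I)
      (Cf : SharpFlatColemanKatoData W p f ϖ κ γ (closureEmb (K := ℚ) (v.adicCompletion ℚ))
        (W.frobeniusTrace p) g c Chroma.flat I),
      Cs.Z = Cf.Z →
    ∀ (Y : W.FineSelmerDualData κ γ) (𝔭 : PrimeSpectrum (IwasawaAlgebra p)), 𝔭.asIdeal.height = 1 →
      (PowerSeries.X : IwasawaAlgebra p) ∉ 𝔭.asIdeal →
      (∃ j : ℕ, 1 ≤ j ∧
        ((((Polynomial.cyclotomic (p ^ j) ℤ).comp (Polynomial.X + 1)).map (Int.castRingHom ℤ_[p]) : Polynomial ℤ_[p]) :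
          PowerSeries ℤ_[p]) ∈ 𝔭.asIdeal) →
      (∀ (col' : Chroma) (G' : IwasawaAlgebra p),
        iwasawaToPowerSeries p G' =
          PowerSeries.C (ϖ : ℚ_[p]) * iwasawaToPowerSeries p (chromaticL col' Lsharp Lflat) →
        G' ∈ 𝔭.asIdeal) →
      min (Module.lengthAt (IwasawaAlgebra p) (IwasawaAlgebra p ⧸ LinearMap.range Cs.colMap) 𝔭)
          (Module.lengthAt (IwasawaAlgebra p) (IwasawaAlgebra p ⧸ LinearMap.range Cf.colMap) 𝔭) ≤
        Module.lengthAt (IwasawaAlgebra p) Y.X 𝔭)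
    (hres : ∀ (W : WeierstrassCurve ℚ) [W.IsElliptic] [W.IsGloballyMinimal] (p : ℕ) [Fact p.Prime]
      [ContinuousSMul ℤ_[p] (W.tateModule p)] [Module.Free ℤ_[p] (W.tateModule p)]
      [Module.Finite ℤ_[p] (W.tateModule p)],
      ClassX8 W p → ∀ (κ : ZpExtension ℚ p) (γ : Field.absoluteGaloisGroup ℚ),
      κ.IsCyclotomic → κ.IsTopGenerator γ → IsCyclotomicVariable p γ →
    ∀ (v : HeightOneSpectrum (𝓞 ℚ)), (p : 𝓞 ℚ) ∈ v.asIdeal →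
    ∀ (g : Field.absoluteGaloisGroup (v.adicCompletion ℚ)),
      κ.IsTopGenerator (resGalOfEmb (closureEmb (K := ℚ) (v.adicCompletion ℚ)) g) →
    ∀ (cneg : localPoints W (v.adicCompletion ℚ)) (c : ℕ → localPoints W (v.adicCompletion ℚ)),
      IsHondaSystem κ (closureEmb (K := ℚ) (v.adicCompletion ℚ)) W (W.frobeniusTrace p) g cneg c →
    ∀ (N : ℕ) (_ : NeZero N) (f : CuspForm (Gamma0 N) 2) (ϖ : ℚ) (Lsharp Lflat : IwasawaAlgebra p),
      IsNewformOf W f → (ϖ : ℝ) * W.realPeriodRat = plusPeriod f →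
      IsSprungPair f p (W.frobeniusTrace p) Lsharp Lflat →
    ∀ (I : Kato2004.IwasawaH1Data W p κ γ)
      (Cs : SharpFlatColemanKatoData W p f ϖ κ γ (closureEmb (K := ℚ) (v.adicCompletion ℚ))
        (W.frobeniusTrace p) g c Chroma.sharp I)
      (Cf : SharpFlatColemanKatoData W p f ϖ κ γ (closureEmb (K := ℚ) (v.adicCompletion ℚ))
        (W.frobeniusTrace p) g c Chroma.flat I),
      Cs.Z = Cf.Z →
    ∀ (Y : W.FineSelmerDualData κ γ) (𝔭 : PrimeSpectrum (IwasawaAlgebra p)), 𝔭.asIdeal.height = 1 →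
      (PowerSeries.X : IwasawaAlgebra p) ∉ 𝔭.asIdeal →
      (∃ j : ℕ, 1 ≤ j ∧
        ((((Polynomial.cyclotomic (p ^ j) ℤ).comp (Polynomial.X + 1)).map (Int.castRingHom ℤ_[p]) : Polynomial ℤ_[p]) :
          PowerSeries ℤ_[p]) ∈ 𝔭.asIdeal) →
      (∀ (col' : Chroma) (G' : IwasawaAlgebra p),
        iwasawaToPowerSeries p G' =
          PowerSeries.C (ϖ : ℚ_[p]) * iwasawaToPowerSeries p (chromaticL col' Lsharp Lflat) →
        G' ∈ 𝔭.asIdeal) →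
      min (Module.lengthAt (IwasawaAlgebra p) (IwasawaAlgebra p ⧸ LinearMap.range Cs.colMap) 𝔭)
          (Module.lengthAt (IwasawaAlgebra p) (IwasawaAlgebra p ⧸ LinearMap.range Cf.colMap) 𝔭) <
          Module.lengthAt (IwasawaAlgebra p) (I.H ⧸ Cs.Z) 𝔭 →
      Module.lengthAt (IwasawaAlgebra p) (I.H ⧸ Cs.Z) 𝔭 ≤ Module.lengthAt (IwasawaAlgebra p) Y.X 𝔭) :
    ∀ (W : WeierstrassCurve ℚ) [W.IsElliptic] [W.IsGloballyMinimal] (p : ℕ) [Fact p.Prime]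
      [ContinuousSMul ℤ_[p] (W.tateModule p)] [Module.Free ℤ_[p] (W.tateModule p)]
      [Module.Finite ℤ_[p] (W.tateModule p)],
      ClassX8 W p → ∀ (col : Chroma) (κ : ZpExtension ℚ p) (γ : Field.absoluteGaloisGroup ℚ),
      κ.IsCyclotomic → κ.IsTopGenerator γ → IsCyclotomicVariable p γ →
    ∀ (v : HeightOneSpectrum (𝓞 ℚ)), (p : 𝓞 ℚ) ∈ v.asIdeal →
    ∀ (g : Field.absoluteGaloisGroup (v.adicCompletion ℚ)),
      κ.IsTopGenerator (resGalOfEmb (closureEmb (K := ℚ) (v.adicCompletion ℚ)) g) →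
    ∀ (cneg : localPoints W (v.adicCompletion ℚ)) (c : ℕ → localPoints W (v.adicCompletion ℚ)),
      IsHondaSystem κ (closureEmb (K := ℚ) (v.adicCompletion ℚ)) W (W.frobeniusTrace p) g cneg c →
    ∀ (N : ℕ) (_ : NeZero N) (f : CuspForm (Gamma0 N) 2) (ϖ : ℚ) (Lsharp Lflat : IwasawaAlgebra p),
      IsNewformOf W f → (ϖ : ℝ) * W.realPeriodRat = plusPeriod f →
      IsSprungPair f p (W.frobeniusTrace p) Lsharp Lflat → chromaticL col Lsharp Lflat ≠ 0 →
    ∀ (D : SharpFlatSelmerDualData W κ γ (closureEmb (K := ℚ) (v.adicCompletion ℚ))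
        (W.frobeniusTrace p) g c col) [Module.Finite (IwasawaAlgebra p) D.X],
      Module.IsTorsion (IwasawaAlgebra p) D.X →
    ∀ (G : IwasawaAlgebra p),
      iwasawaToPowerSeries p G =
        PowerSeries.C (ϖ : ℚ_[p]) * iwasawaToPowerSeries p (chromaticL col Lsharp Lflat) →
    ∀ (I : Kato2004.IwasawaH1Data W p κ γ)
      (Cs : SharpFlatColemanKatoData W p f ϖ κ γ (closureEmb (K := ℚ) (v.adicCompletion ℚ))
        (W.frobeniusTrace p) g c Chroma.sharp I)
      (Cf : SharpFlatColemanKatoData W p f ϖ κ γ (closureEmb (K := ℚ) (v.adicCompletion ℚ))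
        (W.frobeniusTrace p) g c Chroma.flat I),
      Cs.Z = Cf.Z →
    ∀ 𝔭 : PrimeSpectrum (IwasawaAlgebra p), 𝔭.asIdeal.height = 1 →
      (PowerSeries.X : IwasawaAlgebra p) ∉ 𝔭.asIdeal →
      (∃ j : ℕ, 1 ≤ j ∧
        ((((Polynomial.cyclotomic (p ^ j) ℤ).comp (Polynomial.X + 1)).map (Int.castRingHom ℤ_[p]) : Polynomial ℤ_[p]) :
          PowerSeries ℤ_[p]) ∈ 𝔭.asIdeal) →
      (∀ (col' : Chroma) (G' : IwasawaAlgebra p),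
        iwasawaToPowerSeries p G' =
          PowerSeries.C (ϖ : ℚ_[p]) * iwasawaToPowerSeries p (chromaticL col' Lsharp Lflat) →
        G' ∈ 𝔭.asIdeal) →
      Module.lengthAt (IwasawaAlgebra p) (IwasawaAlgebra p ⧸ Ideal.span {G}) 𝔭 ≤
        Module.lengthAt (IwasawaAlgebra p) D.X 𝔭 := by
  refine stub_cyclotomicLowerPosLevel_of_katoFineLowerAt ?_
  intro W _ _ p _ _ _ _ hX κ γ hκ hγ hcv v hv g hg cneg c hH N hN f ϖ Lsharp Lflat hf hϖ hSP I Cs Cf hZ Y 𝔭 h𝔭 hT hΦ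
    hcommon
  by_cases hkj : Module.lengthAt (IwasawaAlgebra p) (I.H ⧸ Cs.Z) 𝔭 ≤
      min (Module.lengthAt (IwasawaAlgebra p) (IwasawaAlgebra p ⧸ LinearMap.range Cs.colMap) 𝔭)
          (Module.lengthAt (IwasawaAlgebra p) (IwasawaAlgebra p ⧸ LinearMap.range Cf.colMap) 𝔭)
  · exact hkj.trans (hFα W p hX κ γ hκ hγ hcv v hv g hg cneg c hH N hN f ϖ Lsharp Lflat hf hϖ hSP I Cs Cf hZ Y 𝔭 h𝔭 hT hΦ hcommon)
  · exact hres W p hX κ γ hκ hγ hcv v hv g hg cneg c hH N hN f ϖ Lsharp Lflat hf hϖ hSP I Cs Cf hZ Y 𝔭 h𝔭 hT hΦ hcommon (not_le.mp hkj)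

end Summit.BirchSwinnertonDyer.BirchSwinnertonDyer.Theorems.ChromaticCommonZeros

end
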